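import Summits.BirchSwinnertonDyer.BirchSwinnertonDyer.Theorems.ByReductionTypeAtTwoTowerClassKit
import Summits.BirchSwinnertonDyer.BirchSwinnertonDyer.Theorems.ByReductionTypeAtTwoAnalyticMuLETwo
import HarnessLib

/-!
# Route `ByReductionTypeAtTwo` (K4), TOWER road — the W-generic TOWER doors WITHOUT the `μ_an = 0` certificate:
# on {`GoodOrd W 2`, `Irr W 2`} the binders `hper₀`, `htors` AND `hμan` are all consequences of `hAU` + `Irr`

Cell `bsd-2adic`, seat `bsd-2adic-tower-1` (GEN 24), `--supports stmt-BirchSwinnertonDyer-19271` (helper).  Theorems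
only; no definition, no named fact beyond the DISPLAYED print hypotheses of the existing doors (`h17` Kato 17.4@2, `h414`
Greenberg Prop. 4.14@2, `hAU` Abbes–Ullmo, `hEC` Greenberg Thm. 4.1@2, `hmod`, `hGZK`); no `sorry`.

The W-generic TOWER doors `KatoHalfPinch.katoHalfAt_two_of_towerGap_of_layerSelmer` /
`…mazurMainConjecture_two_of_towerGap_of_layerSelmer` / `…bsdp_two_of_towerGap_of_layerSelmer` (and their `towerRank`
forms) take, besides print and the descent certificates, THREE per-curve inputs that are free on the `E[2]`-irreducible
locus: `hper₀` (from `hAU` + `Irr`: `TowerClass.periodRatio_nonneg_of_irr_two_of_abbesUllmo`), `htors`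
(`TowerClass.not_two_dvd_torsionOrder_of_irr`) and — NEW, this seat's `ByReductionTypeAtTwoAnalyticMuZero` /
`…AnalyticMuLETwo` — the CERTIFICATE `hμan : AnalyticMuLE W 2 0` (`AnalyticMuTwo.analyticMuLE_two_zero_of_goodOrd_of_irr_of_abbesUllmo`).
This file records the resulting doors, keyed on `hAU` + `Irr W 2` and carrying ONE certificate fewer:

* `katoHalfAt_two_of_towerGap_of_layerSelmer_of_irr` — the item `OrdKatoHalfAtTwo` (19271) AT `W`;
* `mazurMainConjecture_two_of_towerGap_of_layerSelmer_of_irr` — the `2`-adic IMC at `W`;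
* `bsdp_two_of_towerGap_of_layerSelmer_of_irr` — `BSDp W 2` at analytic rank `0`;
* `…_of_towerRank_of_irr` — the same three over an abstract tower-rank certificate.

Every one of the 440 `E[2]`-irreducible X5@2 good-ordinary TOWER class displays (`Theorems/ByReductionTypeAtTwoTowerClass<label>.lean`,
binder `(hμan : AnalyticMuLE c<label> 2 0)`) can be re-keyed to these by name, dropping `hμan`; whether and when is the
planner's call (D-0152: census frozen) — nothing is re-keyed here.  HONEST FRAMING: conditional on the displayed print
binders exactly as the parent doors; closes nothing by itself; BSD is not proved by any of this.

References: [Kato2004Asterisque] Thm. 17.4 (1)(2); [GreenbergLNM1716] Thm. 4.1, Prop. 4.14, §1 Conj. 1.11;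
[AbbesUllmo1996] Thm. A; [Miller2011LMS] Def. 1.1.
-/

set_option autoImplicit false
-- justification: the mandated namespace `Summit.BirchSwinnertonDyer.BirchSwinnertonDyer.Theorems`
-- (single-conjunct summit, Sub = Summit) repeats a segment by design (D-0017).
set_option linter.dupNamespace false

noncomputable section

open scoped Classical MatrixGroups ModularForm

open NumberField IsDedekindDomain CongruenceSubgroup WeierstrassCurve Literature.NumberTheory.EllipticCurves
  Literature.NumberTheory.EllipticCurves.ModularForms Literature.NumberTheory.EllipticCurves.Rank1Residual
  Literature.NumberTheory.EllipticCurves.Rank1Residual.Typed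
  Literature.NumberTheory.EllipticCurves.Greenberg1999
  Literature.NumberTheory.EllipticCurves.SkinnerUrban2014
  Summit.BirchSwinnertonDyer.Rank1Residual.X1.MuLambda
  Summit.BirchSwinnertonDyer.Rank1Residual.X1.MuPart
  Summit.BirchSwinnertonDyer.Rank1Residual.X1.ParitySqueeze
  Summit.BirchSwinnertonDyer.BirchSwinnertonDyer.Theorems.Rank1ResidualX1Defs
  Summit.BirchSwinnertonDyer.Rank1Residual.X5 Summit.BirchSwinnertonDyer.Rank1Residual.X5.O1
  Summit.BirchSwinnertonDyer.Rank1Residual.X5.TowerGap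
  Summit.BirchSwinnertonDyer.BirchSwinnertonDyer.Theorems.KatoHalfPinch
  Summit.BirchSwinnertonDyer.BirchSwinnertonDyer.Theorems.AnalyticMuTwo

namespace Summit.BirchSwinnertonDyer.BirchSwinnertonDyer.Theorems.TowerClass

section LayerSelmer

variable (W : WeierstrassCurve ℚ) [W.IsElliptic] [W.IsGloballyMinimal]

/-- **The Kato–Néron half (item `OrdKatoHalfAtTwo` AT `W`), layer form, WITHOUT the `μ_an` certificate**: PRINT
{`h17`, `h414`, `hAU`} + kernel {`GoodOrd W 2`, `Irr W 2`} + certificates {`TowerGapAtTwo W`,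
`2ⁿ ≤ #Sel_{2^∞}(E/ℚ_j)[2]`, `λ_an = n`}.  `hper₀`, `htors`, `hμan` of `katoHalfAt_two_of_towerGap_of_layerSelmer` are
supplied by `periodRatio_nonneg_of_irr_two_of_abbesUllmo`, `not_two_dvd_torsionOrder_of_irr`,
`analyticMuLE_two_zero_of_goodOrd_of_irr_of_abbesUllmo`. [cite: Kato2004Asterisque, Thm. 17.4 (1)(2) (p. 273)]
[cite: GreenbergLNM1716, Prop. 4.14 (§4)] [cite: AbbesUllmo1996, Thm. A] -/
theorem katoHalfAt_two_of_towerGap_of_layerSelmer_of_irr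
    (h17 : ∀ [NeZero (W.conductorNorm ℤ)] (f : CuspForm (Gamma0 (W.conductorNorm ℤ)) 2),
      kato_divisibility_allPrimes W 2 (f := f))
    (h414 : prop414_noFiniteSubmodule_of_not_dvd_torsionOrder)
    (hAU : abbesUllmo_not_dvd_maninConstant_of_not_dvd_level) (hgo : GoodOrd W 2) (hirr : Irr W 2)
    (hgap : TowerGapAtTwo W) {j n : ℕ}
    (hsel : ∀ κ : ZpExtension ℚ 2, κ.IsCyclotomic →
      2 ^ n ≤ Nat.card {z : W.selmerLayer κ j // 2 • z = 0})
    (hlan : AnalyticLambdaEq W 2 n) : MainConjectureLowerDivisibilityAtTwoOrd W :=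
  katoHalfAt_two_of_towerGap_of_layerSelmer W h17 h414 (periodRatio_nonneg_of_irr_two_of_abbesUllmo W hAU hgo hirr)
    hgo (not_two_dvd_torsionOrder_of_irr W hirr) hgap hsel hlan
    (analyticMuLE_two_zero_of_goodOrd_of_irr_of_abbesUllmo W hAU hgo hirr)

/-- **The `2`-adic IMC at `W`, layer form, WITHOUT the `μ_an` certificate** (any analytic rank): PRINT {`h17`, `h414`,
`hAU`} + kernel {`GoodOrd W 2`, `Irr W 2`} + certificates {`TowerGapAtTwo W`, layer count, `λ_an = n`}.
[cite: Kato2004Asterisque, Thm. 17.4 (1)(2) (p. 273)] [cite: GreenbergLNM1716, Prop. 4.14 (§4)] [cite: AbbesUllmo1996, Thm. A] -/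
theorem mazurMainConjecture_two_of_towerGap_of_layerSelmer_of_irr
    (h17 : ∀ [NeZero (W.conductorNorm ℤ)] (f : CuspForm (Gamma0 (W.conductorNorm ℤ)) 2),
      kato_divisibility_allPrimes W 2 (f := f))
    (h414 : prop414_noFiniteSubmodule_of_not_dvd_torsionOrder)
    (hAU : abbesUllmo_not_dvd_maninConstant_of_not_dvd_level) (hgo : GoodOrd W 2) (hirr : Irr W 2)
    (hgap : TowerGapAtTwo W) {j n : ℕ}
    (hsel : ∀ κ : ZpExtension ℚ 2, κ.IsCyclotomic →
      2 ^ n ≤ Nat.card {z : W.selmerLayer κ j // 2 • z = 0})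
    (hlan : AnalyticLambdaEq W 2 n) : MazurMainConjecture W 2 :=
  mazurMainConjecture_two_of_towerGap_of_layerSelmer W h17 h414
    (periodRatio_nonneg_of_irr_two_of_abbesUllmo W hAU hgo hirr) hgo (not_two_dvd_torsionOrder_of_irr W hirr) hgap
    hsel hlan (analyticMuLE_two_zero_of_goodOrd_of_irr_of_abbesUllmo W hAU hgo hirr)

/-- **`BSDp W 2` at analytic rank `0`, layer form, WITHOUT the `μ_an` certificate**: PRINT {`hmod`, `hGZK`, `h17`, `hEC`,
`h414`, `hAU`} + kernel {`GoodOrd W 2`, `Irr W 2`} + `hr` + certificates {`TowerGapAtTwo W`, layer count, `λ_an = n`}.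
[cite: GreenbergLNM1716, Thm. 4.1 (p. 102), Prop. 4.14 (§4)] [cite: Kato2004Asterisque, Thm. 17.4 (1)(2) (p. 273)]
[cite: AbbesUllmo1996, Thm. A] [cite: Miller2011LMS, Def. 1.1] -/
theorem bsdp_two_of_towerGap_of_layerSelmer_of_irr (hmod : nonempty_modularParametrizationData)
    (hGZK : rank_eq_analyticRank_of_analyticRank_le_one)
    (h17 : ∀ [NeZero (W.conductorNorm ℤ)] (f : CuspForm (Gamma0 (W.conductorNorm ℤ)) 2),
      kato_divisibility_allPrimes W 2 (f := f))
    (hEC : TwoAdicEulerCharRankZero W 0) (h414 : prop414_noFiniteSubmodule_of_not_dvd_torsionOrder)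
    (hAU : abbesUllmo_not_dvd_maninConstant_of_not_dvd_level) (hgo : GoodOrd W 2) (hirr : Irr W 2)
    (hr : W.analyticRank = 0) (hgap : TowerGapAtTwo W) {j n : ℕ}
    (hsel : ∀ κ : ZpExtension ℚ 2, κ.IsCyclotomic →
      2 ^ n ≤ Nat.card {z : W.selmerLayer κ j // 2 • z = 0})
    (hlan : AnalyticLambdaEq W 2 n) : BSDp W 2 :=
  bsdp_two_of_towerGap_of_layerSelmer W hmod hGZK h17 hEC h414
    (periodRatio_nonneg_of_irr_two_of_abbesUllmo W hAU hgo hirr) hgo hr (not_two_dvd_torsionOrder_of_irr W hirr)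
    hgap hsel hlan (analyticMuLE_two_zero_of_goodOrd_of_irr_of_abbesUllmo W hAU hgo hirr)

end LayerSelmer

section TowerRank

variable (W : WeierstrassCurve ℚ) [W.IsElliptic] [W.IsGloballyMinimal]

/-- **The Kato–Néron half AT `W`, tower-rank form, WITHOUT the `μ_an` certificate.**
[cite: Kato2004Asterisque, Thm. 17.4 (1)(2) (p. 273)] [cite: GreenbergLNM1716, Prop. 4.14 (§4)] [cite: AbbesUllmo1996, Thm. A] -/
theorem katoHalfAt_two_of_towerGap_of_towerRank_of_irr
    (h17 : ∀ [NeZero (W.conductorNorm ℤ)] (f : CuspForm (Gamma0 (W.conductorNorm ℤ)) 2),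
      kato_divisibility_allPrimes W 2 (f := f))
    (h414 : prop414_noFiniteSubmodule_of_not_dvd_torsionOrder)
    (hAU : abbesUllmo_not_dvd_maninConstant_of_not_dvd_level) (hgo : GoodOrd W 2) (hirr : Irr W 2)
    (hgap : TowerGapAtTwo W) {n : ℕ}
    (hrank : ∀ (κ : ZpExtension ℚ 2) (γ : Field.absoluteGaloisGroup ℚ), κ.IsCyclotomic →
      κ.IsTopGenerator γ → IsCyclotomicVariable 2 γ → ∀ D : W.SelmerDualData κ γ,
      ∃ j : ℕ, 2 ^ n ≤ Nat.card (D.X ⧸ (towerIdeal 2 j • ⊤ : Submodule (IwasawaAlgebra 2) D.X)))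
    (hlan : AnalyticLambdaEq W 2 n) : MainConjectureLowerDivisibilityAtTwoOrd W :=
  katoHalfAt_two_of_towerGap_of_towerRank W h17 h414 (periodRatio_nonneg_of_irr_two_of_abbesUllmo W hAU hgo hirr)
    hgo (not_two_dvd_torsionOrder_of_irr W hirr) hgap hrank hlan
    (analyticMuLE_two_zero_of_goodOrd_of_irr_of_abbesUllmo W hAU hgo hirr)

/-- **The `2`-adic IMC at `W`, tower-rank form, WITHOUT the `μ_an` certificate.**
[cite: Kato2004Asterisque, Thm. 17.4 (1)(2) (p. 273)] [cite: GreenbergLNM1716, Prop. 4.14 (§4)] [cite: AbbesUllmo1996, Thm. A] -/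
theorem mazurMainConjecture_two_of_towerGap_of_towerRank_of_irr
    (h17 : ∀ [NeZero (W.conductorNorm ℤ)] (f : CuspForm (Gamma0 (W.conductorNorm ℤ)) 2),
      kato_divisibility_allPrimes W 2 (f := f))
    (h414 : prop414_noFiniteSubmodule_of_not_dvd_torsionOrder)
    (hAU : abbesUllmo_not_dvd_maninConstant_of_not_dvd_level) (hgo : GoodOrd W 2) (hirr : Irr W 2)
    (hgap : TowerGapAtTwo W) {n : ℕ}
    (hrank : ∀ (κ : ZpExtension ℚ 2) (γ : Field.absoluteGaloisGroup ℚ), κ.IsCyclotomic →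
      κ.IsTopGenerator γ → IsCyclotomicVariable 2 γ → ∀ D : W.SelmerDualData κ γ,
      ∃ j : ℕ, 2 ^ n ≤ Nat.card (D.X ⧸ (towerIdeal 2 j • ⊤ : Submodule (IwasawaAlgebra 2) D.X)))
    (hlan : AnalyticLambdaEq W 2 n) : MazurMainConjecture W 2 :=
  mazurMainConjecture_two_of_towerGap_of_towerRank W h17 h414
    (periodRatio_nonneg_of_irr_two_of_abbesUllmo W hAU hgo hirr) hgo (not_two_dvd_torsionOrder_of_irr W hirr) hgap
    hrank hlan (analyticMuLE_two_zero_of_goodOrd_of_irr_of_abbesUllmo W hAU hgo hirr)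

/-- **`BSDp W 2` at analytic rank `0`, tower-rank form, WITHOUT the `μ_an` certificate.**
[cite: GreenbergLNM1716, Thm. 4.1 (p. 102), Prop. 4.14 (§4)] [cite: Kato2004Asterisque, Thm. 17.4 (1)(2) (p. 273)]
[cite: AbbesUllmo1996, Thm. A] [cite: Miller2011LMS, Def. 1.1] -/
theorem bsdp_two_of_towerGap_of_towerRank_of_irr (hmod : nonempty_modularParametrizationData)
    (hGZK : rank_eq_analyticRank_of_analyticRank_le_one)
    (h17 : ∀ [NeZero (W.conductorNorm ℤ)] (f : CuspForm (Gamma0 (W.conductorNorm ℤ)) 2),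
      kato_divisibility_allPrimes W 2 (f := f))
    (hEC : TwoAdicEulerCharRankZero W 0) (h414 : prop414_noFiniteSubmodule_of_not_dvd_torsionOrder)
    (hAU : abbesUllmo_not_dvd_maninConstant_of_not_dvd_level) (hgo : GoodOrd W 2) (hirr : Irr W 2)
    (hr : W.analyticRank = 0) (hgap : TowerGapAtTwo W) {n : ℕ}
    (hrank : ∀ (κ : ZpExtension ℚ 2) (γ : Field.absoluteGaloisGroup ℚ), κ.IsCyclotomic →
      κ.IsTopGenerator γ → IsCyclotomicVariable 2 γ → ∀ D : W.SelmerDualData κ γ,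
      ∃ j : ℕ, 2 ^ n ≤ Nat.card (D.X ⧸ (towerIdeal 2 j • ⊤ : Submodule (IwasawaAlgebra 2) D.X)))
    (hlan : AnalyticLambdaEq W 2 n) : BSDp W 2 :=
  bsdp_two_of_towerGap_of_towerRank W hmod hGZK h17 hEC h414
    (periodRatio_nonneg_of_irr_two_of_abbesUllmo W hAU hgo hirr) hgo hr (not_two_dvd_torsionOrder_of_irr W hirr)
    hgap hrank hlan (analyticMuLE_two_zero_of_goodOrd_of_irr_of_abbesUllmo W hAU hgo hirr)

end TowerRank

end Summit.BirchSwinnertonDyer.BirchSwinnertonDyer.Theorems.TowerClass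

end
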